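/-
Copyright (c) 2026 the pub-hodgecm-mathlib formalisation cell (harness21).  Prover seat hodgecm-mathlib-K2Liu-p12 (g2): Track B «K2-LIT»,
#184♮ = hLiu418 = stmt-HodgeConjecture-24832; Road Φ of socket #41, organ Φ4-EXACT (LEAD F0P6-plan ruling «M-157p»), file E1b.
-/
import Summits.HodgeConjecture.HodgeConjecture.Theorems.K2LiuWhittakerContentProfile   -- ★ E1a: `φ_s(w_Δ n X) = t^e` on the content strata
import Summits.HodgeConjecture.HodgeConjecture.Theorems.K2LiuGoodPlaceWhittakerBound    -- ★ Φ4 (R-bound): frame letters, ★ F3b lattice facts, ★ F4b-2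
import HarnessLib

/-!
# Crux `HLiu418`, Road Φ of socket #41, organ Φ4-EXACT — FILE E1b: THE CONTENT STRATIFICATION OF A SHELL INTEGRAL

Cell `hodgecm-mathlib`, crux item hLiu418 = `stmt-HodgeConjecture-24832`, route of record `HCCMUnconditional`; squad K2 ∕ K2Liu, road `K2_Liu`,
socket #41 `sig_K2LiuSiegelEisensteinContinuation`, Road Φ, organ Φ4-EXACT (ruling M-157p; method memo `K2/K2Liu-p12/g2/CENSUS-PHI4-EXACT-Method.K2Liu-p12-g2.md`
§1 (b)).  THEOREMS ONLY (no `def`, no `instance`, no `notation`, no named-fact hypothesis, no `sorry`); lane `--supports stmt-HodgeConjecture-24832`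
(count-neutral helper; closes no socket by itself).

WHAT IS PROVED (`n = 2`, a good UNRAMIFIED place: `|2|_w = 1`, `T₀, T₀⁻¹` integral, `v_w(ι_w ϖ) = exp(−1)` at every `w ∣ v`, `χ_w` unramified, `φ_s` spherical).
With the balls `B(a) = {t : ∀ i j w, |t_ij|_w ≤ |ϖ|_w^a}`, the shells `Sh(k) = B(−k) ∖ B(−k+1)` and the DET LEVEL SETS `D(m) = {t : ∀ w, |det t|_w ≤ |ϖ|_w^{−m}}`:
* §1 `Sh(k) ⊆ B(−k) ⊆ D(2k)` (`det` of a `2 × 2` matrix with entries in `ball(−k)`), `D(m)` is measurable and increasing.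
* §2 an abstract telescoping lemma: if `f = t^k ψ` on `Sh ∩ D(k)` and `f = t^m ψ` on `Sh ∩ (D(m) ∖ D(m−1))` for `m ≥ k+1`, then
  `∫_{Sh} f = t^k ∫_{Sh ∩ D(k)} ψ + Σ_{m=k+1}^{N} t^m (∫_{Sh ∩ D(m)} ψ − ∫_{Sh ∩ D(m−1)} ψ)` whenever `Sh ⊆ D(N)`.
* §3 **THE STRATIFICATION OF THE SHELL INTEGRAL**: for the integrand of the unramified Whittaker coefficient (★ E1a gives `φ_s(w_Δ n t) = t^{max(k,d)}` pointwise),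
  `∫_{Sh(k)} φ_s(w_Δ n t) ψ_v(−τ tr(β t)) dμ = t^k·H(k,k) + Σ_{m=k+1}^{2k} t^m·(H(k,m) − H(k,m−1))`, `H(k,m) := ∫_{Sh(k) ∩ D(m)} ψ_v(−τ tr(β t)) dμ`,
  `t = (∏_w χ_w(ι_w ϖ))·(∏_w ‖ι_w ϖ‖_w)^{s+1}`; and §4 `H(k,m) = I(k,m) − I(k−1,m)` with **`I(k,m) := ∫_{B(−k) ∩ D(m)} ψ_v(−τ tr(β t)) dμ`**, plus
  `∫_{B(−k)} = ∫_{B(−k+1)} + ∫_{Sh(k)}` — so the unramified coefficient `∫_{B(−3)}` is a finite combination of the TEN lattice integrals `I(k,m)`,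
  `k ≤ m ≤ 2k ≤ 6`, whose values are the business of E2 (vanishing) and E3∕E4 (the residue quadric).

## References
* [Shimura1997] G. Shimura, *Euler Products and Eisenstein Series*, CBMS 93 (1997), §13.5–13.6, §18–§19.
* [KudlaSweet1997] S. Kudla, W. J. Sweet, Israel J. Math. 98 (1997), §1.   * [Casselman1980] W. Casselman, Compositio Math. 40 (1980), §3.
* [KudlaRallis1994] S. Kudla, S. Rallis, Ann. of Math. 140 (1994), §2.
-/

set_option autoImplicit false
-- the mandated namespace repeats the single-problem summit's segment (`HodgeConjecture.HodgeConjecture`)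
set_option linter.dupNamespace false

noncomputable section

open scoped NNReal ENNReal Matrix Topology ValuativeRel
open NumberField IsDedekindDomain Matrix MeasureTheory Set Filter ValuativeRel
open Literature.NumberTheory.Automorphic Literature.NumberTheory.Automorphic.UnitaryGroup
open Literature.NumberTheory.GelbartRogawski1991.AdaptedBlocks
open Literature.NumberTheory.GelbartRogawski1991.UnitaryDualPair.LocalSplitting
open Literature.NumberTheory.K2Lit.LocalSiegelDoubled
open Summit.HodgeConjecture.HodgeConjecture.Cruxes.HLiu418.K2LiuLocalRingValuationBalls
open Summit.HodgeConjecture.HodgeConjecture.Cruxes.HLiu418.K2LiuSkewLatticeShells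
open Summit.HodgeConjecture.HodgeConjecture.Cruxes.HLiu418.K2LiuBadPlaceWhittakerHeads
open Summit.HodgeConjecture.HodgeConjecture.Cruxes.HLiu418.K2LiuLocalSiegelIwasawa
open Summit.HodgeConjecture.HodgeConjecture.Cruxes.HLiu418.K2LiuWhittakerContentProfile

namespace Summit.HodgeConjecture.HodgeConjecture.Cruxes.HLiu418.K2LiuWhittakerContentStrata

/-! ## §1 Det level sets: `B(−k) ⊆ D(2k)`, measurability, monotonicity -/

section Sets

variable (F : Type) [Field F] [NumberField F] (E : Type) [Field E] [NumberField E] [Algebra F E]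
  (c : E ≃ₐ[F] E) (v : HeightOneSpectrum (𝓞 F)) {π : v.adicCompletion F} (hπ : Valued.v π = WithZero.exp (-1 : ℤ))

include hπ in
/-- `2 × 2`: entries in `ball a` ⇒ `det ∈ ball (a + a)`. [cite: Shimura1997, §13.5] -/
theorem det_mem_ball_two {a : ℤ} {X : Matrix (Fin 2) (Fin 2) (LocalRing E v)}
    (hX : ∀ i j (w : PlacesOver E v), Valued.v (X i j w) ≤ Valued.v (toPlace v w π) ^ a) :
    ∀ w : PlacesOver E v, Valued.v (X.det w) ≤ Valued.v (toPlace v w π) ^ (a + a) := by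
  rw [Matrix.det_fin_two, sub_eq_add_neg]
  exact ball_add F E v (ball_mul F E v hπ (hX 0 0) (hX 1 1)) (ball_neg F E v (ball_mul F E v hπ (hX 0 1) (hX 1 0)))

include hπ in
/-- the det level set `D(m) ∩ S` is measurable (it is open). [folklore] -/
theorem measurableSet_detLevel (S : AddSubgroup (Matrix (Fin 2) (Fin 2) (LocalRing E v))) [MeasurableSpace S] [BorelSpace S] (m : ℤ) :
    MeasurableSet {t : S | ∀ w : PlacesOver E v, Valued.v (t.1.det w) ≤ Valued.v (toPlace v w π) ^ m} := by
  have h : {t : S | ∀ w : PlacesOver E v, Valued.v (t.1.det w) ≤ Valued.v (toPlace v w π) ^ m} =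
      ⋂ w : PlacesOver E v, (fun t : S => t.1.det w) ⁻¹' {x : w.1.adicCompletion E | Valued.v x ≤ Valued.v (toPlace v w π) ^ m} := by
    ext t; simp only [mem_setOf_eq, mem_iInter, mem_preimage]
  rw [h]
  refine (isOpen_iInter_of_finite fun w => ?_).measurableSet
  exact (isOpen_setOf_valued_le F E v hπ m w).preimage ((continuous_apply w).comp (continuous_subtype_val.matrix_det))

include hπ in
/-- the det level sets increase: `D(m) ⊆ D(m')` for `m ≤ m'`. [folklore] -/
theorem detLevel_mono (S : AddSubgroup (Matrix (Fin 2) (Fin 2) (LocalRing E v))) {m m' : ℤ} (h : m ≤ m') :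
    {t : S | ∀ w : PlacesOver E v, Valued.v (t.1.det w) ≤ Valued.v (toPlace v w π) ^ (-m)} ⊆
      {t : S | ∀ w : PlacesOver E v, Valued.v (t.1.det w) ≤ Valued.v (toPlace v w π) ^ (-m')} :=
  fun _ ht => ball_antitone F E v hπ (neg_le_neg h) ht

end Sets

/-! ## §2 Telescoping over det levels (abstract) -/

/-- **telescoping over the det levels.**  `Sh`, `D(m)` measurable, `μ Sh < ∞`, `D` increasing with `Sh ⊆ D(N)`; if `f = t^k·ψ` on `Sh ∩ D(k)` and
`f = t^m·ψ` on `Sh ∩ (D(m) ∖ D(m−1))` for every `m ≥ k+1`, then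
`∫_{Sh} f = t^k ∫_{Sh ∩ D(k)} ψ + Σ_{m=k+1}^{N} t^m (∫_{Sh ∩ D(m)} ψ − ∫_{Sh ∩ D(m−1)} ψ)`. [cite: Shimura1997, §13.6] [cite: Casselman1980, §3] -/
theorem setIntegral_eq_sum_levels {V : Type*} [MeasurableSpace V] (μ : Measure V) {Sh : Set V} (hSh : MeasurableSet Sh)
    {D : ℕ → Set V} (hD : ∀ m, MeasurableSet (D m)) (hmono : ∀ m, D m ⊆ D (m + 1)) {k N : ℕ} (hkN : k ≤ N) (htop : Sh ⊆ D N)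
    {f ψ : V → ℂ} (hf : IntegrableOn f Sh μ) (hψ : IntegrableOn ψ Sh μ) (t : ℂ)
    (hbase : ∀ x ∈ Sh ∩ D k, f x = t ^ k * ψ x) (hstep : ∀ m, k + 1 ≤ m → ∀ x ∈ Sh ∩ (D m \ D (m - 1)), f x = t ^ m * ψ x) :
    ∫ x in Sh, f x ∂μ = t ^ k * ∫ x in Sh ∩ D k, ψ x ∂μ +
      ∑ m ∈ Finset.Ioc k N, t ^ m * (∫ x in Sh ∩ D m, ψ x ∂μ - ∫ x in Sh ∩ D (m - 1), ψ x ∂μ) := by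
  -- telescoping identity
  have tele : ∀ (g : ℕ → ℂ) (n : ℕ), k ≤ n → g n = g k + ∑ m ∈ Finset.Ioc k n, (g m - g (m - 1)) := by
    intro g n hn
    induction n, hn using Nat.le_induction with
    | base => simp
    | succ n hn ih => rw [Finset.sum_Ioc_succ_top hn, Nat.add_sub_cancel, ← add_assoc, ← ih]; ring
  have hG : ∀ m, k + 1 ≤ m → ∫ x in Sh ∩ D m, f x ∂μ - ∫ x in Sh ∩ D (m - 1), f x ∂μ =
      t ^ m * (∫ x in Sh ∩ D m, ψ x ∂μ - ∫ x in Sh ∩ D (m - 1), ψ x ∂μ) := by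
    intro m hm
    have hDD : D (m - 1) ⊆ D m := by
      have h := hmono (m - 1)
      rwa [Nat.sub_add_cancel (by omega)] at h
    have hsub : Sh ∩ D (m - 1) ⊆ Sh ∩ D m := inter_subset_inter_right _ hDD
    rw [← setIntegral_sdiff (hSh.inter (hD _)) (hf.mono_set inter_subset_left) hsub,
      ← setIntegral_sdiff (hSh.inter (hD _)) (hψ.mono_set inter_subset_left) hsub, ← inter_sdiff_distrib_left, ← integral_const_mul]
    exact setIntegral_congr_fun (hSh.inter ((hD m).diff (hD _))) (hstep m hm)
  rw [show ∫ x in Sh, f x ∂μ = ∫ x in Sh ∩ D N, f x ∂μ by rw [inter_eq_left.2 htop],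
    tele (fun m => ∫ x in Sh ∩ D m, f x ∂μ) N hkN]
  congr 1
  · rw [← integral_const_mul]; exact setIntegral_congr_fun (hSh.inter (hD k)) hbase
  · exact Finset.sum_congr rfl fun m hm => hG m (by rw [Finset.mem_Ioc] at hm; omega)

/-! ## §3 The stratification of the shell integral (`n = 2`) -/

section Strata

variable (F : Type) [Field F] [NumberField F] (E : Type) [Field E] [NumberField E] [Algebra F E]
  [Algebra.IsQuadraticExtension F E] (c : E ≃ₐ[F] E) {δ : E} (hcδ : c δ = -δ) (hδ : δ ≠ 0) {dd : F} (hd : δ * δ = algebraMap F E dd)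
  (v : HeightOneSpectrum (𝓞 F)) {T₀ : Matrix (Fin 2) (Fin 2) F} (hT₀ : T₀.IsSymm) (hT₀d : IsUnit T₀.det)
  {JD : Matrix (Fin (2 + 2)) (Fin (2 + 2)) E} (hJD : JD = (gramD F 2 T₀).map (algebraMap F E))
  {π : v.adicCompletion F} (hπ : Valued.v π = WithZero.exp (-1 : ℤ)) (hπw : ∀ w : PlacesOver E v, Valued.v (toPlace v w π) = WithZero.exp (-1 : ℤ))

include hcδ hδ hd hT₀ hT₀d hJD hπ hπw in
/-- **THE STRATIFICATION OF THE SHELL INTEGRAL.**  At a good unramified place, for the spherical section `φ_s` of `I_v(s,χ_v)` (`χ_w` unramified),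
ANY matrix `β` and the Whittaker character `ψ_v(−τ tr(β t))`, on the shell `Sh(k) = B(−k) ∖ B(−k+1)`:
`∫_{Sh(k)} φ_s(w_Δ n t)·ψ_v(−τ tr(βt)) dμ = t^k·∫_{Sh(k) ∩ D(k)} ψ_v(−τ tr(βt)) dμ + Σ_{m=k+1}^{2k} t^m·(∫_{Sh(k) ∩ D(m)} − ∫_{Sh(k) ∩ D(m−1)}) ψ_v(−τ tr(βt)) dμ`,
`D(m) = {∀ w, |det t|_w ≤ |ϖ|_w^{−m}}`, `t = (∏_w χ_w(ι_w ϖ))·(∏_w ‖ι_w ϖ‖_w)^{s+1}` (★ E1a pointwise + §2).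
[cite: Shimura1997, §13.6, §18] [cite: KudlaSweet1997, §1] [cite: Casselman1980, §3] -/
theorem setIntegral_shell_eq_strata
    (S : AddSubgroup (Matrix (Fin 2) (Fin 2) (LocalRing E v)))
    (hS : ∀ t, t ∈ S ↔ (t.map (conjLocal E c v))ᵀ * gramS F E v 2 T₀ + gramS F E v 2 T₀ * t = 0)
    [MeasurableSpace S] [BorelSpace S] (μ : Measure S) [μ.IsAddHaarMeasure]
    (h2v : ∀ w : PlacesOver E v, valuation (w.1.adicCompletion E) (2 : w.1.adicCompletion E) = 1)
    (hT : ∀ (w : PlacesOver E v) (i j : Fin 2),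
      valuation (w.1.adicCompletion E) (algebraMap E (w.1.adicCompletion E) (algebraMap F E (T₀ i j))) ≤ 1)
    (hTinv : ∀ (w : PlacesOver E v) (i j : Fin 2),
      valuation (w.1.adicCompletion E) (algebraMap E (w.1.adicCompletion E) (algebraMap F E (T₀⁻¹ i j))) ≤ 1)
    {χv : ∀ w : PlacesOver E v, (w.1.adicCompletion E)ˣ →* ℂˣ}
    (hχur : ∀ (w : PlacesOver E v) (x : (w.1.adicCompletion E)ˣ), Valued.v (x : w.1.adicCompletion E) = 1 → χv w x = 1)
    (hϖ0 : ∀ w : PlacesOver E v, toPlace v w π ≠ 0)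
    {s : ℂ} {φs : UnitaryGroup.localPi E c (2 + 2) JD v → ℂ} (hφ : IsSphericalSection F E c hcδ hδ hd v 2 hT₀ hJD χv s φs)
    {ψ : AddChar (v.adicCompletion F) Circle} (hψ : Continuous ψ) {τ : LocalRing E v → v.adicCompletion F} (hτc : Continuous τ)
    (β : Matrix (Fin 2) (Fin 2) (LocalRing E v)) (k : ℕ) :
    ∫ t in {t : S | ∀ i j (w : PlacesOver E v), Valued.v (t.1 i j w) ≤ Valued.v (toPlace v w π) ^ (-(k : ℤ))} \
        {t : S | ∀ i j (w : PlacesOver E v), Valued.v (t.1 i j w) ≤ Valued.v (toPlace v w π) ^ (-(k : ℤ) + 1)},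
        φs (weylDelta F E c v 2 hJD * nElem F E c v 2 hJD t.1 ((hS t.1).1 t.2)) * ((ψ (-τ (Matrix.trace (β * t.1))) : Circle) : ℂ) ∂μ =
      ((((∏ w : PlacesOver E v, χv w (Units.mk0 (toPlace v w π) (hϖ0 w))) : ℂˣ) : ℂ) *
          (((∏ w : PlacesOver E v, ‖toPlace v w π‖) : ℝ) : ℂ) ^ (s + 1)) ^ k *
        ∫ t in ({t : S | ∀ i j (w : PlacesOver E v), Valued.v (t.1 i j w) ≤ Valued.v (toPlace v w π) ^ (-(k : ℤ))} \
            {t : S | ∀ i j (w : PlacesOver E v), Valued.v (t.1 i j w) ≤ Valued.v (toPlace v w π) ^ (-(k : ℤ) + 1)}) ∩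
            {t : S | ∀ w : PlacesOver E v, Valued.v (t.1.det w) ≤ Valued.v (toPlace v w π) ^ (-(k : ℤ))},
          ((ψ (-τ (Matrix.trace (β * t.1))) : Circle) : ℂ) ∂μ +
      ∑ m ∈ Finset.Ioc k (2 * k),
        ((((∏ w : PlacesOver E v, χv w (Units.mk0 (toPlace v w π) (hϖ0 w))) : ℂˣ) : ℂ) *
            (((∏ w : PlacesOver E v, ‖toPlace v w π‖) : ℝ) : ℂ) ^ (s + 1)) ^ m *
          (∫ t in ({t : S | ∀ i j (w : PlacesOver E v), Valued.v (t.1 i j w) ≤ Valued.v (toPlace v w π) ^ (-(k : ℤ))} \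
              {t : S | ∀ i j (w : PlacesOver E v), Valued.v (t.1 i j w) ≤ Valued.v (toPlace v w π) ^ (-(k : ℤ) + 1)}) ∩
              {t : S | ∀ w : PlacesOver E v, Valued.v (t.1.det w) ≤ Valued.v (toPlace v w π) ^ (-(m : ℤ))},
            ((ψ (-τ (Matrix.trace (β * t.1))) : Circle) : ℂ) ∂μ -
           ∫ t in ({t : S | ∀ i j (w : PlacesOver E v), Valued.v (t.1 i j w) ≤ Valued.v (toPlace v w π) ^ (-(k : ℤ))} \
              {t : S | ∀ i j (w : PlacesOver E v), Valued.v (t.1 i j w) ≤ Valued.v (toPlace v w π) ^ (-(k : ℤ) + 1)}) ∩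
              {t : S | ∀ w : PlacesOver E v, Valued.v (t.1.det w) ≤ Valued.v (toPlace v w π) ^ (-((m - 1 : ℕ) : ℤ))},
            ((ψ (-τ (Matrix.trace (β * t.1))) : Circle) : ℂ) ∂μ) := by
  -- regularity
  have hfc : Continuous φs :=
    continuous_of_rightInvariant (UnitaryGroup.isOpen_localInt E c (2 + 2) JD v) fun g k hk => hφ.apply_mul_of_mem_localInt hk g
  have hφm : Measurable fun t : S => φs (weylDelta F E c v 2 hJD * nElem F E c v 2 hJD t.1 ((hS t.1).1 t.2)) :=
    measurable_pullback F E c v 2 hJD S hS hfc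
  have hχcont : Continuous fun t : S => ((ψ (-τ (Matrix.trace (β * t.1))) : Circle) : ℂ) :=
    continuous_subtype_val.comp (hψ.comp (hτc.comp (continuous_const.matrix_mul continuous_subtype_val).matrix_trace).neg)
  have hχ1 : ∀ t : S, ‖((ψ (-τ (Matrix.trace (β * t.1))) : Circle) : ℂ)‖ ≤ 1 := fun t => by rw [Circle.norm_coe]
  -- the sets
  set Sh : Set S := {t : S | ∀ i j (w : PlacesOver E v), Valued.v (t.1 i j w) ≤ Valued.v (toPlace v w π) ^ (-(k : ℤ))} \
      {t : S | ∀ i j (w : PlacesOver E v), Valued.v (t.1 i j w) ≤ Valued.v (toPlace v w π) ^ (-(k : ℤ) + 1)} with hShdef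
  set D : ℕ → Set S := fun m => {t : S | ∀ w : PlacesOver E v, Valued.v (t.1.det w) ≤ Valued.v (toPlace v w π) ^ (-(m : ℤ))} with hDdef
  have hShm : MeasurableSet Sh := (measurableSet_ball F E v hπ 2 S _).diff (measurableSet_ball F E v hπ 2 S _)
  have hShμ : μ Sh ≠ ∞ := ((measure_mono (fun _ h => h.1)).trans_lt (lt_top_iff_ne_top.2 (measure_ball_ne_top F E c v hπ 2 S hS μ _))).ne
  have hDm : ∀ m, MeasurableSet (D m) := fun m => measurableSet_detLevel F E v hπ S _
  have hmono : ∀ m : ℕ, D m ⊆ D (m + 1) := fun m => detLevel_mono F E v hπ S (by push_cast; omega)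
  have htop : Sh ⊆ D (2 * k) := fun t ht w => by
    have h := det_mem_ball_two F E v hπ (X := t.1) ht.1 w
    rwa [show -(k : ℤ) + -(k : ℤ) = -((2 * k : ℕ) : ℤ) by push_cast; ring] at h
  -- integrability on the shell
  obtain ⟨C, hC⟩ := exists_bound_pullback_of_isCompact F E c v 2 hJD S hS hfc (isCompact_ball F E c v hπ 2 S hS (-(k : ℤ)))
  have hf : IntegrableOn (fun t : S => φs (weylDelta F E c v 2 hJD * nElem F E c v 2 hJD t.1 ((hS t.1).1 t.2)) *
      ((ψ (-τ (Matrix.trace (β * t.1))) : Circle) : ℂ)) Sh μ :=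
    integrableOn_mul_of_bound μ hShm hShμ hφm hχcont.measurable hχ1 fun t ht => hC t (ht.1)
  have hψi : IntegrableOn (fun t : S => ((ψ (-τ (Matrix.trace (β * t.1))) : Circle) : ℂ)) Sh μ := by
    have h := integrableOn_mul_of_bound μ hShm hShμ measurable_const hχcont.measurable hχ1 (C := 1) (φ := fun _ => (1 : ℂ))
      (fun t _ => by rw [norm_one])
    simpa only [one_mul] using h
  -- the Iwasawa factorisation and the pointwise values (★ E1a)
  have hIw := fun t : S => exists_isSiegelDelta_mul_mem_localInt F E c hcδ hδ hd v 2 hT₀ hJD hT₀d h2v hT hTinv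
    (weylDelta F E c v 2 hJD * nElem F E c v 2 hJD t.1 ((hS t.1).1 t.2))
  have hbase : ∀ t ∈ Sh ∩ D k, φs (weylDelta F E c v 2 hJD * nElem F E c v 2 hJD t.1 ((hS t.1).1 t.2)) *
      ((ψ (-τ (Matrix.trace (β * t.1))) : Circle) : ℂ) =
      ((((∏ w : PlacesOver E v, χv w (Units.mk0 (toPlace v w π) (hϖ0 w))) : ℂˣ) : ℂ) *
          (((∏ w : PlacesOver E v, ‖toPlace v w π‖) : ℝ) : ℂ) ^ (s + 1)) ^ k * ((ψ (-τ (Matrix.trace (β * t.1))) : Circle) : ℂ) := by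
    rintro t ⟨⟨htk, htk1⟩, htd⟩
    obtain ⟨p, k', hp, hk', hg⟩ := hIw t
    have hwit : ∃ (i j : Fin 2) (w : PlacesOver E v), ¬ Valued.v (t.1 i j w) ≤ Valued.v (toPlace v w π) ^ (-(k : ℤ) + 1) := by
      by_contra h
      push Not at h
      exact htk1 h
    rw [apply_weylDelta_nElem_eq_pow_of_shell F E c hcδ hδ hd v hT₀ hT₀d hJD hπw χv hχur s hφ hϖ0 h2v t.1 ((hS t.1).1 t.2) hp hk' hg
      htk htd hwit]
  have hstep : ∀ m, k + 1 ≤ m → ∀ t ∈ Sh ∩ (D m \ D (m - 1)),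
      φs (weylDelta F E c v 2 hJD * nElem F E c v 2 hJD t.1 ((hS t.1).1 t.2)) * ((ψ (-τ (Matrix.trace (β * t.1))) : Circle) : ℂ) =
      ((((∏ w : PlacesOver E v, χv w (Units.mk0 (toPlace v w π) (hϖ0 w))) : ℂˣ) : ℂ) *
          (((∏ w : PlacesOver E v, ‖toPlace v w π‖) : ℝ) : ℂ) ^ (s + 1)) ^ m * ((ψ (-τ (Matrix.trace (β * t.1))) : Circle) : ℂ) := by
    rintro m hm t ⟨⟨htk, -⟩, htd, htd1⟩
    obtain ⟨p, k', hp, hk', hg⟩ := hIw t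
    have hwit : ∃ w : PlacesOver E v, ¬ Valued.v (t.1.det w) ≤ Valued.v (toPlace v w π) ^ (-(m : ℤ) + 1) := by
      by_contra h
      push Not at h
      refine htd1 fun w => ?_
      have h' := h w
      rwa [show (-(m : ℤ) + 1) = -((m - 1 : ℕ) : ℤ) by omega] at h'
    rw [apply_weylDelta_nElem_eq_pow_of_detLevel F E c hcδ hδ hd v hT₀ hT₀d hJD hπw χv hχur s hφ hϖ0 h2v t.1 ((hS t.1).1 t.2) hp hk' hg
      (by omega) htk htd hwit]
  exact setIntegral_eq_sum_levels μ hShm hDm hmono (by omega) htop hf hψi _ hbase hstep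

/-! ## §4 Shell-to-ball bookkeeping for the character integrals -/

include c hπ in
omit [Algebra.IsQuadraticExtension F E] in
/-- `H(k,m) = I(k,m) − I(k−1,m)`: `∫_{Sh(k) ∩ D} ψ = ∫_{B(−k) ∩ D} ψ − ∫_{B(−k+1) ∩ D} ψ` for any measurable `D` and any bounded measurable `ψ`.
[cite: Casselman1980, §3] -/
theorem setIntegral_shell_inter_eq_sub
    (S : AddSubgroup (Matrix (Fin 2) (Fin 2) (LocalRing E v)))
    (hS : ∀ t, t ∈ S ↔ (t.map (conjLocal E c v))ᵀ * gramS F E v 2 T₀ + gramS F E v 2 T₀ * t = 0)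
    [MeasurableSpace S] [BorelSpace S] (μ : Measure S) [μ.IsAddHaarMeasure]
    {D : Set S} (hD : MeasurableSet D) {g : S → ℂ} (hgm : Measurable g) (hg1 : ∀ t, ‖g t‖ ≤ 1) (k : ℤ) :
    ∫ t in ({t : S | ∀ i j (w : PlacesOver E v), Valued.v (t.1 i j w) ≤ Valued.v (toPlace v w π) ^ (-k)} \
        {t : S | ∀ i j (w : PlacesOver E v), Valued.v (t.1 i j w) ≤ Valued.v (toPlace v w π) ^ (-k + 1)}) ∩ D, g t ∂μ =
      ∫ t in {t : S | ∀ i j (w : PlacesOver E v), Valued.v (t.1 i j w) ≤ Valued.v (toPlace v w π) ^ (-k)} ∩ D, g t ∂μ -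
        ∫ t in {t : S | ∀ i j (w : PlacesOver E v), Valued.v (t.1 i j w) ≤ Valued.v (toPlace v w π) ^ (-k + 1)} ∩ D, g t ∂μ := by
  have hsub : {t : S | ∀ i j (w : PlacesOver E v), Valued.v (t.1 i j w) ≤ Valued.v (toPlace v w π) ^ (-k + 1)} ∩ D ⊆
      {t : S | ∀ i j (w : PlacesOver E v), Valued.v (t.1 i j w) ≤ Valued.v (toPlace v w π) ^ (-k)} ∩ D :=
    inter_subset_inter_left _ (ball_antitone F E v hπ 2 S (by omega))
  have hint : IntegrableOn g ({t : S | ∀ i j (w : PlacesOver E v), Valued.v (t.1 i j w) ≤ Valued.v (toPlace v w π) ^ (-k)} ∩ D) μ := by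
    have hm := (measurableSet_ball F E v hπ 2 S (-k)).inter hD
    have hμ : μ ({t : S | ∀ i j (w : PlacesOver E v), Valued.v (t.1 i j w) ≤ Valued.v (toPlace v w π) ^ (-k)} ∩ D) ≠ ∞ :=
      ((measure_mono inter_subset_left).trans_lt (lt_top_iff_ne_top.2 (measure_ball_ne_top F E c v hπ 2 S hS μ _))).ne
    have h := integrableOn_mul_of_bound μ hm hμ measurable_const hgm hg1 (C := 1) (φ := fun _ => (1 : ℂ)) (fun t _ => by rw [norm_one])
    simpa only [one_mul] using h
  have hset : ({t : S | ∀ i j (w : PlacesOver E v), Valued.v (t.1 i j w) ≤ Valued.v (toPlace v w π) ^ (-k)} \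
        {t : S | ∀ i j (w : PlacesOver E v), Valued.v (t.1 i j w) ≤ Valued.v (toPlace v w π) ^ (-k + 1)}) ∩ D =
      ({t : S | ∀ i j (w : PlacesOver E v), Valued.v (t.1 i j w) ≤ Valued.v (toPlace v w π) ^ (-k)} ∩ D) \
        ({t : S | ∀ i j (w : PlacesOver E v), Valued.v (t.1 i j w) ≤ Valued.v (toPlace v w π) ^ (-k + 1)} ∩ D) := by
    ext t
    simp only [mem_inter_iff, Set.mem_sdiff]
    tauto
  rw [← setIntegral_sdiff ((measurableSet_ball F E v hπ 2 S _).inter hD) hint hsub, hset]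

include hπ in
omit [Algebra.IsQuadraticExtension F E] in
/-- `∫_{B(−k)} f = ∫_{B(−k+1)} f + ∫_{Sh(k)} f` for `f` integrable on `B(−k)`. [cite: Casselman1980, §3] -/
theorem setIntegral_ball_eq_add_shell
    (S : AddSubgroup (Matrix (Fin 2) (Fin 2) (LocalRing E v)))
    [MeasurableSpace S] [BorelSpace S] (μ : Measure S) {f : S → ℂ} (k : ℤ)
    (hf : IntegrableOn f {t : S | ∀ i j (w : PlacesOver E v), Valued.v (t.1 i j w) ≤ Valued.v (toPlace v w π) ^ (-k)} μ) :
    ∫ t in {t : S | ∀ i j (w : PlacesOver E v), Valued.v (t.1 i j w) ≤ Valued.v (toPlace v w π) ^ (-k)}, f t ∂μ =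
      ∫ t in {t : S | ∀ i j (w : PlacesOver E v), Valued.v (t.1 i j w) ≤ Valued.v (toPlace v w π) ^ (-k + 1)}, f t ∂μ +
        ∫ t in {t : S | ∀ i j (w : PlacesOver E v), Valued.v (t.1 i j w) ≤ Valued.v (toPlace v w π) ^ (-k)} \
          {t : S | ∀ i j (w : PlacesOver E v), Valued.v (t.1 i j w) ≤ Valued.v (toPlace v w π) ^ (-k + 1)}, f t ∂μ := by
  rw [setIntegral_sdiff (measurableSet_ball F E v hπ 2 S _) hf (ball_antitone F E v hπ 2 S (by omega))]
  ring

end Strata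

end Summit.HodgeConjecture.HodgeConjecture.Cruxes.HLiu418.K2LiuWhittakerContentStrata

end
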